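import Summits.NavierStokesRegularity.NavierStokesRegularity.Theorems.HodographBetchovDeepSlowGradientPressure
import Literature.Analysis.FluidPDE.NSCriticalClosureBesovKatoClass
import Literature.Analysis.FluidPDE.KatoRieszPressureSuitable
import Literature.Analysis.FluidPDE.NSBoundedHigherRegularityQuantProofs

/-!
# Route `HodographBetchov`, support `DeepSlowGradient` (stmt-NavierStokesRegularity-15836):
# the gradient bound at Reynolds number one — PROVED

`deepSlowGradient_proof : Summit.NavierStokesRegularity.NavierStokesRegularity.Theses.HodographBetchov.DeepSlowGradient`:
for `ν, l, A > 0` there is `C` such that for every classical solution `(u, p)` of the unforced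
Navier–Stokes system on `ℝ³ × [0, T)` which is Leray–Hopf from its rapidly decaying datum with
`∫ |u 0|² ≤ A`, every `t₀ ∈ [ν/l², T)` and every `x₀`: if `|u| ≤ l` on the backward parabolic
cylinder `[t₀ − ν/l², t₀] × B̄(x₀, ν/l)` (Reynolds number `l · (ν/l) / ν = 1`), then
`‖∇u(t₀, x₀)‖ ≤ C` (in fact `C = K₀ · l²/ν` with `K₀` depending on `A l/ν³`-type data only through
the pressure budget below).

## Proof

All analytic inputs are theorems of the tree; the pressure budget and the continuity of `∇u` up
to the top time are in the helper file `Theorems/HodographBetchovDeepSlowGradientPressure.lean`.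

1. *Pressure.* The classical Leray–Hopf solution is a Kato `C_t L³` solution
   (`isKatoSolutionOn_of_classical`); on the closed sub-slab `[0, S]`, `S = (t₀ + T)/2`, the
   space–time Riesz pressure `π` (`exists_spaceTime_rieszPressure`: jointly measurable, `L^{3/2}` on
   the slab, slices `Π[u(t)]` with Stein's bound `‖π(t)‖_{3/2} ≤ C_{3/2} ‖u(t)‖₃²`) makes `(u, π)` a
   distributional solution on `(0, S) × ℝ³` (`IsKatoSolutionOn.distributional_slab_of_pressure`),
   hence on the cylinder `(t₀ − ν/l², t₀) × B(x₀, ν/l)` (`IsDistributionalNSSolutionOn.mono_holds`).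
2. *Normalisation.* `Φ(s, y) = (t₀ + (ν/l²) s, x₀ + (ν/l) y)` and the amplitude `1/l` rescale
   `(u, π)` to a distributional solution `(w, q)` with viscosity `1` on the unit cylinder
   `Q(1) = ]−1, 0[ × B(0, 1)` (`IsDistributionalNSSolutionOn.stRescale`,
   `stAffine_preimage_cylinder_eq_parabolicCylinder`), and `|w| ≤ 1` there by the hypothesis.
3. *Pressure budget* `∫∫_{Q(1)} |q|^{3/2} ≤ P(ν, l, A)` (`lintegral_rescaled_pressure_le`).
4. *Local regularity with constants fixed before the solution.* Seregin–Šverák's quantitative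
   higher interior regularity (`NSBoundedHigherRegularityBounds_holds`) gives `K₀ = K₀(P)` and a
   representative `V` of `w` with `‖D_y V‖ ≤ K₀` on `Q(1/2)`; `V = w` on the open cylinder, so
   `(l⁻¹ · ν/l) ‖∇u ∘ Φ‖ ≤ K₀` on `Q(1/2)` (`mul_norm_fderiv_le_of_representative`), and continuity
   of `∇u` up to `t₀ < T` gives the bound at the top centre
   (`mul_norm_fderiv_le_of_forall_cylinder`): `‖∇u(t₀, x₀)‖ ≤ K₀ l²/ν`.

References: J. Serrin, Arch. Rational Mech. Anal. 9 (1962) 187–195; G. Seregin, V. Šverák,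
Comm. PDE 34 (2009) = arXiv:0804.1803, §2 p. 8; L. Caffarelli, R. Kohn, L. Nirenberg, Comm. Pure
Appl. Math. 35 (1982) §2 (scaling); P. G. Lemarié-Rieusset, *The Navier–Stokes Problem in the 21st
Century* (2016), Prop. 6.5 and Thm. 15.1.
-/

noncomputable section

-- the summit and its single sub-problem share the name (CONVENTIONS §1), as in every Theorems file
set_option linter.dupNamespace false

namespace Summit.NavierStokesRegularity.NavierStokesRegularity.Theorems

open Set MeasureTheory Function Metric Filter Topology TopologicalSpace Literature.Analysis.FluidPDE
open scoped ENNReal NNReal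
open DeepSlowGradient

/-- **Transfer of the gradient bound from Seregin–Šverák's representative.** Let `(u, p)` be a
classical solution on `(0, T)`, `0 < β ≤ t₀ < T`, `αγ ≥ 0`, and let `V` be a representative of the
rescaled field `w = α u ∘ Φ`, `Φ(s, y) = (t₀ + β s, x₀ + γ y)`, on the unit cylinder `Q(1)`
(`w = V` a.e. there, `V` continuous on `Q(1)`) with `‖D_y V‖ ≤ K₀` on `Q(1/2)`. Then
`αγ ‖∇u(Φ(s, y))‖ ≤ K₀` on `Q(1/2)`: `w = V` on the open cylinder (both continuous,
`Measure.eqOn_open_of_ae_eq`), so their spatial derivatives agree there, and `∇w = αγ ∇u ∘ Φ`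
(chain rule). [folklore] -/
theorem DeepSlowGradient.mul_norm_fderiv_le_of_representative {ν T : ℝ}
    {u : ℝ → EuclideanSpace ℝ (Fin 3) → EuclideanSpace ℝ (Fin 3)}
    {p : ℝ → EuclideanSpace ℝ (Fin 3) → ℝ} (hclo : IsClassicalNSSolutionOn (Ioo 0 T) ν 0 u p)
    {t₀ β γ α K₀ : ℝ} {x₀ : EuclideanSpace ℝ (Fin 3)} (hβ0 : 0 < β) (hβt₀ : β ≤ t₀) (ht₀T : t₀ < T)
    (hαγ : 0 ≤ α * γ) {V : ℝ → EuclideanSpace ℝ (Fin 3) → EuclideanSpace ℝ (Fin 3)}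
    (hae : uncurry (α • stPull β γ t₀ x₀ u) =ᵐ[volume.restrict
      (parabolicCylinder 1 ((0 : ℝ), (0 : EuclideanSpace ℝ (Fin 3))))] uncurry V)
    (hVcont : ContinuousOn (uncurry V) (parabolicCylinder 1 ((0 : ℝ), (0 : EuclideanSpace ℝ (Fin 3)))))
    (hVbd : ∀ z ∈ parabolicCylinder (1 / 2) ((0 : ℝ), (0 : EuclideanSpace ℝ (Fin 3))),
      ‖iteratedFDeriv ℝ 1 (V z.1) z.2‖ ≤ K₀) :
    ∀ z ∈ parabolicCylinder (1 / 2) ((0 : ℝ), (0 : EuclideanSpace ℝ (Fin 3))),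
      (α * γ) * ‖fderiv ℝ (u (t₀ + β * z.1)) (x₀ + γ • z.2)‖ ≤ K₀ := by
  set cyl : Set (ℝ × EuclideanSpace ℝ (Fin 3)) :=
    parabolicCylinder 1 ((0 : ℝ), (0 : EuclideanSpace ℝ (Fin 3))) with hcyl_def
  -- the cylinder, read through `Φ`, stays in `(0, T) × ℝ³`
  have htime : ∀ s : ℝ, -1 < s → s ≤ 0 → t₀ + β * s ∈ Ioo 0 T := by
    intro s h1 h2
    have h3 : β * (-1) < β * s := mul_lt_mul_of_pos_left h1 hβ0
    have h4 : β * s ≤ 0 := mul_nonpos_of_nonneg_of_nonpos hβ0.le h2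
    constructor <;> nlinarith
  have hmaps : MapsTo (stAffine β γ t₀ x₀) cyl (Ioo 0 T ×ˢ (univ : Set (EuclideanSpace ℝ (Fin 3)))) := by
    intro z hz
    rw [hcyl_def, mem_parabolicCylinder] at hz
    obtain ⟨⟨h1, h2⟩, -⟩ := hz
    simp only [one_pow, zero_sub] at h1
    exact mk_mem_prod (htime z.1 h1 h2.le) (mem_univ _)
  -- `w` is continuous on the cylinder, hence `w = V` there
  have hucont : ContinuousOn (uncurry u) (Ioo 0 T ×ˢ univ) := hclo.smooth_velocity.continuousOn
  have hwcont : ContinuousOn (uncurry (α • stPull β γ t₀ x₀ u)) cyl := by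
    have h1 : ContinuousOn (fun z => uncurry u (stAffine β γ t₀ x₀ z)) cyl :=
      hucont.comp (continuous_stAffine β γ t₀ x₀).continuousOn hmaps
    have h2 : uncurry (α • stPull β γ t₀ x₀ u) = fun z => α • uncurry u (stAffine β γ t₀ x₀ z) := by
      funext z
      rfl
    rw [h2]
    exact h1.const_smul α
  have heqOn : EqOn (uncurry (α • stPull β γ t₀ x₀ u)) (uncurry V) cyl :=
    Measure.eqOn_open_of_ae_eq hae (isOpen_parabolicCylinder _ _) hwcont hVcont
  -- the bound, point by point on `Q(1/2)`
  intro z hz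
  have hz' := hz
  rw [mem_parabolicCylinder] at hz'
  obtain ⟨⟨h1, h2⟩, h3⟩ := hz'
  simp only [zero_sub] at h1
  rw [dist_zero_right] at h3
  have hs1 : z.1 ∈ Ioo ((0 : ℝ) - 1 ^ 2) 0 := ⟨by nlinarith, h2⟩
  have hy1 : z.2 ∈ ball (0 : EuclideanSpace ℝ (Fin 3)) 1 := by
    rw [mem_ball, dist_zero_right]; linarith
  -- `w s = V s` near `y`, so the spatial derivatives agree
  have hev : (α • stPull β γ t₀ x₀ u) z.1 =ᶠ[𝓝 z.2] V z.1 := by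
    filter_upwards [isOpen_ball.mem_nhds hy1] with y' hy'
    exact heqOn (show (z.1, y') ∈ cyl from mk_mem_prod hs1 hy')
  have hfd : fderiv ℝ ((α • stPull β γ t₀ x₀ u) z.1) z.2 = fderiv ℝ (V z.1) z.2 := hev.fderiv_eq
  have hnorm : ‖fderiv ℝ (V z.1) z.2‖ = ‖iteratedFDeriv ℝ 1 (V z.1) z.2‖ := by
    rw [← norm_iteratedFDeriv_fderiv, norm_iteratedFDeriv_zero]
  -- the gradient of `w` through `u`
  have hsS : t₀ + β * z.1 ∈ Ioo 0 T := htime z.1 (by nlinarith) h2.le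
  have hdiff : Differentiable ℝ (u (t₀ + β * z.1)) :=
    (hclo.contDiff_velocity hsS).differentiable (by simp)
  have hfw : fderiv ℝ ((α • stPull β γ t₀ x₀ u) z.1) z.2 =
      (α * γ) • fderiv ℝ (u (t₀ + β * z.1)) (x₀ + γ • z.2) := by
    have e : (α • stPull β γ t₀ x₀ u) z.1 = α • stPull β γ t₀ x₀ u z.1 := rfl
    rw [e, fderiv_const_smul (differentiable_stPull_slice hdiff z.2), fderiv_stPull, smul_smul]
  calc (α * γ) * ‖fderiv ℝ (u (t₀ + β * z.1)) (x₀ + γ • z.2)‖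
      = ‖fderiv ℝ ((α • stPull β γ t₀ x₀ u) z.1) z.2‖ := by
        rw [hfw, norm_smul, Real.norm_of_nonneg hαγ]
    _ = ‖iteratedFDeriv ℝ 1 (V z.1) z.2‖ := by rw [hfd, hnorm]
    _ ≤ K₀ := hVbd z hz

/-- **`DeepSlowGradient` (stmt-NavierStokesRegularity-15836): the gradient bound at Reynolds
number one.** For `ν, l, A > 0` there is `C` such that for every classical solution `(u, p)` of
the unforced Navier–Stokes system on `ℝ³ × [0, T)`, Leray–Hopf from its rapidly decaying datum
with `∫ |u 0|² ≤ A`, every `t₀ ∈ [ν/l², T)` and `x₀`: if `|u| ≤ l` on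
`[t₀ − ν/l², t₀] × B̄(x₀, ν/l)` then `‖∇u(t₀, x₀)‖ ≤ C`. Proof: the Kato `C_t L³` class and the
space–time Riesz pressure make `(u, π)` distributional on the cylinder; the viscosity/amplitude
normalisation `(s, y) ↦ (t₀ + (ν/l²)s, x₀ + (ν/l)y)`, `w = u/l`, lands on the unit cylinder with
`|w| ≤ 1` and pressure budget `P(ν, l, A)` (Stein, interpolation, Sobolev, energy and
dissipation bounds); Seregin–Šverák's quantitative interior regularity with constants fixed
before the solution bounds `∇w` on `Q(1/2)`, and continuity of `∇u` up to `t₀ < T` gives the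
bound at the top centre, `C = K₀ l²/ν`. [cite: SereginSverak2009, §2 p. 8; Serrin1962] -/
theorem deepSlowGradient_proof :
    Summit.NavierStokesRegularity.NavierStokesRegularity.Theses.HodographBetchov.DeepSlowGradient := by
  intro ν l A hν hl hA
  -- ### scaling parameters: `Φ(s, y) = (t₀ + β s, x₀ + γ y)`, amplitude `α`
  obtain ⟨α, hα⟩ : ∃ α : ℝ, α = l⁻¹ := ⟨_, rfl⟩
  obtain ⟨γ, hγ⟩ : ∃ γ : ℝ, γ = ν / l := ⟨_, rfl⟩
  obtain ⟨β, hβ⟩ : ∃ β : ℝ, β = γ ^ 2 / ν := ⟨_, rfl⟩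
  have hα0 : 0 < α := by rw [hα]; positivity
  have hγ0 : 0 < γ := by rw [hγ]; positivity
  have hβ0 : 0 < β := by rw [hβ]; positivity
  have hβαγ : β = α * γ := by rw [hβ, hα, hγ]; field_simp
  have hβeq : β = ν / l ^ 2 := by rw [hβ, hγ]; field_simp
  have hγeq : γ = ν / l := hγ
  have hvisc : α * ν / γ = 1 := by rw [hα, hγ]; field_simp
  have hαγ : 0 < α * γ := mul_pos hα0 hγ0
  have hαl : α * l = 1 := by rw [hα, inv_mul_cancel₀ hl.ne']
  -- ### the pressure budget `P = P(ν, l, A)` and Seregin–Šverák's constant, fixed before the solution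
  obtain ⟨Pbig, hPbig⟩ : ∃ x : ℝ≥0∞, x = ENNReal.ofReal (α ^ 2) ^ (3 / 2 : ℝ) *
      (ENNReal.ofReal ((β * γ ^ 3)⁻¹) * ((steinConstThreeHalves : ℝ≥0∞) ^ (3 / 2 : ℝ) *
        ((((SNormLESNormFDerivOfEqConst (EuclideanSpace ℝ (Fin 3))
          (volume : Measure (EuclideanSpace ℝ (Fin 3))) 2 : ℝ≥0) : ℝ≥0∞) ^ (3 / 2 : ℝ)) *
          (ENNReal.ofReal A ^ (3 / 4 : ℝ) * (ENNReal.ofReal β + ENNReal.ofReal (A / (2 * ν))))))) :=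
    ⟨_, rfl⟩
  have hPtop : Pbig ≠ ⊤ := by
    rw [hPbig]
    refine ENNReal.mul_ne_top (ENNReal.rpow_ne_top_of_nonneg (by norm_num) ENNReal.ofReal_ne_top)
      (ENNReal.mul_ne_top ENNReal.ofReal_ne_top
      (ENNReal.mul_ne_top (ENNReal.rpow_ne_top_of_nonneg (by norm_num) ENNReal.coe_ne_top)
        (ENNReal.mul_ne_top (ENNReal.rpow_ne_top_of_nonneg (by norm_num) ENNReal.coe_ne_top)
          (ENNReal.mul_ne_top (ENNReal.rpow_ne_top_of_nonneg (by norm_num) ENNReal.ofReal_ne_top)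
            (ENNReal.add_ne_top.2 ⟨ENNReal.ofReal_ne_top, ENNReal.ofReal_ne_top⟩)))))
  set P : ℝ≥0 := Pbig.toNNReal with hP
  have hPcoe : (P : ℝ≥0∞) = Pbig := ENNReal.coe_toNNReal hPtop
  obtain ⟨K₀, hK₀⟩ := NSBoundedHigherRegularityBounds_holds.exists_uniform_bound 1 1 P
    (r := 1 / 2) ⟨by norm_num, by norm_num⟩ 1
  refine ⟨K₀ / (α * γ), ?_⟩
  intro T u p hcl hLH hdec hA0 t₀ ht₀ hνt₀ x₀ hslow
  -- ### elementary facts about the times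
  rw [← hβeq] at hνt₀
  have ht₀pos : 0 < t₀ := hβ0.trans_le hνt₀
  have hT : 0 < T := ht₀pos.trans ht₀.2
  obtain ⟨S, hSdef⟩ : ∃ S : ℝ, S = (t₀ + T) / 2 := ⟨_, rfl⟩
  have hS0 : 0 < S := by rw [hSdef]; linarith [ht₀.2]
  have ht₀S : t₀ < S := by rw [hSdef]; linarith [ht₀.2]
  have hST : S < T := by rw [hSdef]; linarith [ht₀.2]
  have hclo : IsClassicalNSSolutionOn (Ioo 0 T) ν 0 u p :=
    hcl.mono Ioo_subset_Ico_self isOpen_Ioo.uniqueDiffOn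
  -- ### the Riesz pressure makes `(u, π)` distributional on the slab `(0, S) × ℝ³`
  have hK : IsKatoSolutionOn T ν (u 0) u := isKatoSolutionOn_of_classical hν hT hcl hLH hdec
  have hC3 : ContinuousInLpOn (Icc 0 S) 3 u :=
    hK.continuousInLpOn.mono (Icc_subset_Ico_right hST)
  obtain ⟨π, -, hπ32, hπsl⟩ := exists_spaceTime_rieszPressure hS0 hC3
  have hDslab : IsDistributionalNSSolutionOn
      (slab (EuclideanSpace ℝ (Fin 3)) (Ioo 0 S) isOpen_Ioo) ν 0 u π :=
    hK.distributional_slab_of_pressure hν hST hπ32 (hπsl.mono fun t ht => ht.2.2.2)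
  -- ### restriction to the cylinder under `(t₀, x₀)` and normalisation to the unit cylinder
  set Q₀ : Opens (ℝ × EuclideanSpace ℝ (Fin 3)) :=
    ⟨Ioo (t₀ - β) t₀ ×ˢ ball x₀ γ, isOpen_Ioo.prod isOpen_ball⟩ with hQ₀
  have hQ₀le : Q₀ ≤ slab (EuclideanSpace ℝ (Fin 3)) (Ioo 0 S) isOpen_Ioo := by
    intro z hz
    have hz' : z ∈ Ioo (t₀ - β) t₀ ×ˢ ball x₀ γ := hz
    exact mem_slab.2 ⟨by linarith [hz'.1.1], hz'.1.2.trans ht₀S⟩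
  have hDQ : IsDistributionalNSSolutionOn Q₀ ν 0 u π :=
    IsDistributionalNSSolutionOn.mono_holds hDslab hQ₀le
  have hcyl : stAffine β γ t₀ x₀ ⁻¹' (Ioo (t₀ - β) t₀ ×ˢ ball x₀ γ) =
      parabolicCylinder 1 ((0 : ℝ), (0 : EuclideanSpace ℝ (Fin 3))) := by
    have h := stAffine_preimage_cylinder_eq_parabolicCylinder hν hγ0 t₀ x₀ γ
    rw [div_self hγ0.ne', ← hβ] at h
    exact h
  have hpre : stPreimage β γ t₀ x₀ Q₀ =
      parabolicCylinderOpens 1 ((0 : ℝ), (0 : EuclideanSpace ℝ (Fin 3))) := by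
    ext z
    change z ∈ stAffine β γ t₀ x₀ ⁻¹' (Ioo (t₀ - β) t₀ ×ˢ ball x₀ γ) ↔
      z ∈ parabolicCylinder 1 ((0 : ℝ), (0 : EuclideanSpace ℝ (Fin 3)))
    rw [hcyl]
  have hDw : IsDistributionalNSSolutionOn
      (parabolicCylinderOpens 1 ((0 : ℝ), (0 : EuclideanSpace ℝ (Fin 3)))) 1 0
      (α • stPull β γ t₀ x₀ u) (α ^ 2 • stPull β γ t₀ x₀ π) := by
    have h := hDQ.stRescale hα0 hγ0 hβαγ t₀ x₀
    rwa [hpre, hvisc, smul_stPull_zero] at h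
  -- `|w| ≤ 1` on the unit cylinder
  have hbd : ∀ᵐ z ∂(volume.restrict (parabolicCylinder 1 ((0 : ℝ), (0 : EuclideanSpace ℝ (Fin 3))))),
      ‖(α • stPull β γ t₀ x₀ u) z.1 z.2‖ ≤ 1 := by
    refine (ae_restrict_iff' (isOpen_parabolicCylinder _ _).measurableSet).2
      (ae_of_all _ fun z hz => ?_)
    rw [mem_parabolicCylinder] at hz
    obtain ⟨⟨h1, h2⟩, h3⟩ := hz
    simp only [one_pow, zero_sub] at h1
    rw [dist_zero_right] at h3
    have ht : t₀ + β * z.1 ∈ Icc (t₀ - ν / l ^ 2) t₀ := by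
      rw [← hβeq]
      have h4 : β * (-1) < β * z.1 := mul_lt_mul_of_pos_left h1 hβ0
      have h5 : β * z.1 ≤ 0 := mul_nonpos_of_nonneg_of_nonpos hβ0.le h2.le
      constructor <;> nlinarith
    have hx : x₀ + γ • z.2 ∈ closedBall x₀ (ν / l) := by
      rw [mem_closedBall, dist_eq_norm, add_sub_cancel_left, norm_smul, Real.norm_of_nonneg hγ0.le,
        ← hγeq]
      nlinarith [norm_nonneg z.2]
    rw [smul_stPull_apply, norm_smul, Real.norm_of_nonneg hα0.le, ← hαl]
    exact mul_le_mul_of_nonneg_left (hslow (t₀ + β * z.1) ht (x₀ + γ • z.2) hx) hα0.le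
  -- ### the pressure budget `∫∫_{Q(1)} |q|^{3/2} ≤ P`
  have hPq : ∫⁻ z in parabolicCylinder 1 ((0 : ℝ), (0 : EuclideanSpace ℝ (Fin 3))),
      ‖(α ^ 2 • stPull β γ t₀ x₀ π) z.1 z.2‖ₑ ^ (3 / 2 : ℝ) ≤ P := by
    have hsl32 : ∀ᵐ t ∂(volume.restrict (Ioo 0 S)),
        eLpNorm (π t) (3 / 2 : ℝ≥0∞) volume ≤
          (steinConstThreeHalves : ℝ≥0∞) * eLpNorm (u t) 3 volume ^ 2 :=
      hπsl.mono fun t ht => ht.2.2.1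
    rw [← hcyl, hPcoe, hPbig]
    exact lintegral_rescaled_pressure_le hν hT hcl hLH hA.le hA0 hsl32 hβ0 hγ0 hνt₀ ht₀S.le
      ht₀.2.le α x₀
  -- ### Seregin–Šverák: a representative with bounded gradient on `Q(1/2)`, and the transfer
  obtain ⟨V, hae, hVcont, -, -, hVbd⟩ :=
    hK₀ _ _ ((0 : ℝ), (0 : EuclideanSpace ℝ (Fin 3))) hDw hbd hPq
  have hgrad := DeepSlowGradient.mul_norm_fderiv_le_of_representative hclo hβ0 hνt₀ ht₀.2 hαγ.le
    hae hVcont (fun z hz => hVbd 1 le_rfl z hz)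
  -- ### continuity of `∇u` up to the top time
  have key := mul_norm_fderiv_le_of_forall_cylinder hclo hβ0 hνt₀ ht₀.2 hgrad
  rw [le_div_iff₀ hαγ, mul_comm]
  exact key

end Summit.NavierStokesRegularity.NavierStokesRegularity.Theorems

end
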